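import Mathlib
import HarnessLib
import Literature.Analysis.FluidPDE.SelfSimilar
import Literature.Analysis.FluidPDE.VectorCalculus

/-!
# Route `UnthreadedDoor`, crux `PoloidalLiouville` (stmt-NavierStokesRegularity-1222), WALL W1 `stub_scalarLiouville` —
# crux idea «netflux-typei-gap» (planner ns-idea-14 g2/g3; ns-wall-crit-1 verdict V8 PASS-WITH-PRICE):
# THE TYPED OBJECTS AND STATEMENTS of the line (Theorems-side twin of the sketch)

Definition file (Theorems-side twin of the crux sketch `Cruxes/PoloidalLiouville/NetFluxTransportSketch.lean`, tree sha12
5fd3888d1cdd, 2026-08-28T19:07Z; namespace `…Theorems.PoloidalLiouville.NetFlux` instead of the sketch's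
`…Cruxes.PoloidalLiouville.NetFlux`; the def BODIES of §0–§3 and of `LineComposition` are VERBATIM; the sketch's §4 glue to
other sketches (`CapSym`, `FarPastCollapse`) is not copied).  Purpose: kernel theorems about the line
(`…Theorems.PoloidalLiouville.NetFlux.typeIVorticityBound` = NF-2, p660105; `Literature.Analysis.FluidPDE.HalfLineOU.halfLineOU_decay`
= NF-3, p658091; the reduction of the stratum target to S⁺) can be stated BY NAME without importing a crux workfile.

Objects: `sphSup`, `sphInf`, `sphOsc` (spherical max / min / oscillation of a scalar about `x₀`), `netFlux` (`r·osc`),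
`IsUnimodalSphere` (saddle-free sphere), `CurledLaw` (hypothesis (E1) of the wall on a time set).
Statements: `NetFluxSubsolution` (NF-1), `OscLeVorticity` (NF-0), `TypeIVorticityBound` (NF-2), `HalfLineOUDecay` (NF-3),
`NetFluxWindowDecay` (S⁺), `UnimodalScalarLiouvilleTypeI` (the line's target = stratum theorem candidate),
`MultiHillScalarLiouvilleTypeI` (typed residual), `LineComposition` (the two compositions the line claims).

WHAT THIS IS NOT: no NS-regularity statement is touched; `PoloidalLiouville` (1222) and its wall `stub_scalarLiouville` stay
OPEN; these are the objects of one crux idea.  `--supports stmt-NavierStokesRegularity-1222 --as helper`.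
Author of the statements: planner ns-idea-14 (card `Cruxes/PoloidalLiouville/Ideas/netflux-typei-gap.md`); filed Theorems-side
by ARM A ns-exp-scalarLiouville g3.
[cite: KochNadirashviliSereginSverak2009, (1.4), §4 (4.6), Thm 5.2 (arXiv:0709.3599)]
-/

noncomputable section

-- the summit and its single sub-problem share the name (CONVENTIONS §1)
set_option linter.dupNamespace false

namespace Summit.NavierStokesRegularity.NavierStokesRegularity.Theorems.PoloidalLiouville.NetFlux

open Set Function Filter Topology MeasureTheory
open scoped RealInnerProductSpace
open Literature.Analysis.FluidPDE

/-- `ℝ³`. -/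
abbrev E3 : Type := EuclideanSpace ℝ (Fin 3)

/-! ### §0 The objects: spherical extrema, oscillation, net flux density, unimodal spheres -/

/-- `max_{S_r(x₀)} f` (for `r > 0` and `f` continuous on the sphere this is attained). -/
def sphSup (f : E3 → ℝ) (x₀ : E3) (r : ℝ) : ℝ := sSup (f '' Metric.sphere x₀ r)

/-- `min_{S_r(x₀)} f`. -/
def sphInf (f : E3 → ℝ) (x₀ : E3) (r : ℝ) : ℝ := sInf (f '' Metric.sphere x₀ r)

/-- Oscillation of `f` over the sphere `S_r(x₀)` — GAUGE INVARIANT for the toroidal potential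
(`T ↦ T + f(r,t)` does not change it). -/
def sphOsc (f : E3 → ℝ) (x₀ : E3) (r : ℝ) : ℝ := sphSup f x₀ r - sphInf f x₀ r

/-- NET FLUX DENSITY `w(r) = r · osc_{S_r} T`: the flux of `ω = ∇T × (x − x₀)` through any surface made of
spherical arcs from `argmin_{S_r} T` to `argmax_{S_r} T`, per unit `dr` (`i_ω vol = dT ∧ r dr`). -/
def netFlux (f : E3 → ℝ) (x₀ : E3) (r : ℝ) : ℝ := r * sphOsc f x₀ r

/-- Saddle-free ("unimodal", one hill / one basin) sphere: every super- and sub-level set of `f|_{S_r(x₀)}` is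
connected — binder-for-binder the hypothesis of `CapSym.UnimodalScalarLiouville`. -/
def IsUnimodalSphere (f : E3 → ℝ) (x₀ : E3) (r : ℝ) : Prop :=
  ∀ c : ℝ, IsPreconnected {x : E3 | ‖x - x₀‖ = r ∧ c < f x} ∧ IsPreconnected {x : E3 | ‖x - x₀‖ = r ∧ f x < c}

/-- Hypothesis (E1) of the wall (the curled potential law) on a time set `𝒯`. -/
def CurledLaw (v : ℝ → E3 → E3) (x₀ : E3) (T : ℝ → E3 → ℝ) (𝒯 : Set ℝ) : Prop :=
  ∀ t ∈ 𝒯, ∀ x, x ≠ x₀ →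
    cross (gradient (fun z => deriv (fun s => T s z) t + inner ℝ (v t z) (gradient (T t) z)
          - Laplacian.laplacian (T t) z) x) (x - x₀) =
      cross (gradient (fun z => inner ℝ (v t z) (z - x₀)) x) (gradient (T t) x)

/-! ### §1 FIRST LEMMA — the net-flux transport law (distributional 1-D subsolution) -/

/-- **(NF-1, first lemma, M/L) Net toroidal flux is a 1-D subsolution.**  `v, T` smooth on a backward window
(`T` off the centre), (E1), `‖v(t,·)‖_∞ ≤ V(t)`, every sphere saddle-free.  THEN `w(t,r) = r·osc_{S_r(x₀)}T(t)`
satisfies `w_t ≤ w_rr − ∂_r I` with `|I| ≤ V(t) w` in the sense of distributions on `(t₀,0) × (0,∞)`: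
for every smooth compactly supported `ψ ≥ 0`,
`0 ≤ ∬ w (∂_tψ + ∂_r²ψ) + V w |∂_rψ| dr dt`.
(No Navier–Stokes, no `div v = 0`, no boundedness of `T` is used: it is a law of the system (E1) alone.  The
integrands are continuous and compactly supported for the data in question, so the Bochner integrals are honest.)
Mechanism: envelope identity at the spherical extrema + `Δ_S T ≤ 0` at a max / `≥ 0` at a min + radial envelope
convexity + `I = Π(x⁺) − Π(x⁻) = ∫ m dT` along a monotone (gradient) arc. -/
def NetFluxSubsolution : Prop :=
  ∀ (v : ℝ → E3 → E3) (x₀ : E3) (T : ℝ → E3 → ℝ) (V : ℝ → ℝ) (t₀ : ℝ),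
    ContDiffOn ℝ (⊤ : ℕ∞) (uncurry v) (Ioo t₀ 0 ×ˢ univ) →
    ContDiffOn ℝ (⊤ : ℕ∞) (uncurry T) (Ioo t₀ 0 ×ˢ ({x₀}ᶜ : Set E3)) →
    (∀ t ∈ Ioo t₀ 0, ∀ x, ‖v t x‖ ≤ V t) →
    CurledLaw v x₀ T (Ioo t₀ 0) →
    (∀ t ∈ Ioo t₀ 0, ∀ r > 0, IsUnimodalSphere (T t) x₀ r) →
    ∀ ψ : ℝ → ℝ → ℝ, ContDiff ℝ (⊤ : ℕ∞) (uncurry ψ) → HasCompactSupport (uncurry ψ) →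
      tsupport (uncurry ψ) ⊆ Ioo t₀ 0 ×ˢ Ioi 0 → (∀ t r, 0 ≤ ψ t r) →
      0 ≤ ∫ t, ∫ r, (netFlux (T t) x₀ r * (deriv (fun s => ψ s r) t + iteratedDeriv 2 (ψ t) r)
                      + V t * netFlux (T t) x₀ r * |deriv (ψ t) r|)

/-- **(NF-0, support, S) A priori size of the net flux.**  `osc_{S_r} T ≤ π · sup_{S_r} ‖ω‖`
(`|∇_{S_r} T| = ‖ω‖/r`, geodesic diameter `πr`); with `ω(x₀) = 0` for a toroidal field also `≤ π r ‖∇ω‖_∞`. -/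
def OscLeVorticity : Prop :=
  ∀ (v : E3 → E3) (x₀ : E3) (T : E3 → ℝ) (r K : ℝ), 0 < r →
    ContDiff ℝ 1 v → ContDiffOn ℝ 1 T ({x₀}ᶜ) →
    (∀ x, curl v x = cross (gradient T x) (x - x₀)) →
    (∀ x ∈ Metric.sphere x₀ r, ‖curl v x‖ ≤ K) →
    sphOsc T x₀ r ≤ Real.pi * K

/-- **(NF-2, support, M) Type-I velocity ⇒ Type-I vorticity** for bounded ancient mild solutions
(KNSS smoothing `‖∇v‖ ≤ K·sup|v|²` at the end of a window, `exists_norm_fderiv_le_sq_of_isKNSSDriftMild`,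
plus scaling). -/
def TypeIVorticityBound : Prop :=
  ∀ (v : ℝ → E3 → E3) (C : ℝ), IsBoundedAncientMildSolution 1 v → HasTypeITimeDecay C v →
    ContDiffOn ℝ (⊤ : ℕ∞) (uncurry v) (Iio 0 ×ˢ univ) →
    ∃ C₁ : ℝ, ∀ t < 0, ∀ x, ‖curl (v t) x‖ ≤ C₁ / (-t)

/-! ### §2 The 1-D input: half-line Dirichlet–Ornstein–Uhlenbeck decay (cubic growth class) -/

/-- **(NF-3, M) Half-line Dirichlet–OU decay, cubic growth.**  For `C ≥ 0` there are `λ > 0`, `A` such that every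
classical subsolution `U(s,ρ) ≥ 0` of `U_s ≤ U_ρρ + (C − ρ/2) U_ρ` on `(s₁,∞) × (0,∞)`, continuous up to
`ρ = 0` with `U(s,0) = 0` and `U ≤ c(1+ρ)³`, decays: `U(s,ρ) ≤ A c (1+ρ)³ e^{−λ(s−s₁)}`.
Same family as the tree's `TypeIDrift.halfLineOUBarrier_explicit` (operator `4k″ + (2C − ρ/2)k′`, i.e. the
normal form `k″ + (C′ − σ)k′` with `C′ = √2·C` here), but the profile must dominate `(1+ρ)³`, not `1+ρ`.
(The line needs the version for continuous distributional subsolutions — `U` is `C¹` in `ρ` with Lipschitz `U_ρ`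
— obtained from this one by mollification in `ρ`.) -/
def HalfLineOUDecay : Prop :=
  ∀ C : ℝ, 0 ≤ C → ∃ lam > 0, ∃ A : ℝ, ∀ (U : ℝ → ℝ → ℝ) (s₁ c : ℝ),
    ContinuousOn (uncurry U) (Ici s₁ ×ˢ Ici 0) →
    (∀ s, s₁ < s → ContDiffOn ℝ 2 (U s) (Ioi 0)) →
    (∀ ρ, 0 < ρ → DifferentiableOn ℝ (fun s => U s ρ) (Ioi s₁)) →
    (∀ s, s₁ ≤ s → U s 0 = 0) →
    (∀ s, s₁ ≤ s → ∀ ρ, 0 ≤ ρ → 0 ≤ U s ρ ∧ U s ρ ≤ c * (1 + ρ) ^ 3) →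
    (∀ s, s₁ < s → ∀ ρ, 0 < ρ →
        deriv (fun σ => U σ ρ) s ≤ iteratedDeriv 2 (U s) ρ + (C - ρ / 2) * deriv (U s) ρ) →
    ∀ s, s₁ ≤ s → ∀ ρ, 0 ≤ ρ → U s ρ ≤ A * c * (1 + ρ) ^ 3 * Real.exp (-lam * (s - s₁))

/-! ### §3 S⁺ (the strengthened, window-wise statement) and the targets -/

/-- **(S⁺, L) Window decay of the net toroidal flux in the Type-I class.**  For every Type-I constant `C` there are
`λ > 0`, `A` such that for smooth `(v,T)` on a backward window with `‖v‖ ≤ C/√(−t)`, `‖ω‖ ≤ C₁/(−t)`,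
`ω = ∇T × (x − x₀)`, (E1) and saddle-free spheres,
`∫₀^R r·osc_{S_r}T(t) dr ≤ A·C₁·(1 + R/√(−t))³·(t/t₁)^λ` for `t₀ < t₁ ≤ t < 0`
(the left side is the cumulative flux `U(s, R/√(−t))`; a priori it is `≤ (π/2) C₁ (R/√(−t))²`).
TRUE ON WINDOWS for all such data — not only ancient ones — which is what makes it attackable (comparison on
`[s₁, s]`, no compactness / blow-down); the crux follows by `t₁ → −∞`. -/
def NetFluxWindowDecay : Prop :=
  ∀ C : ℝ, 0 ≤ C → ∃ lam > (0 : ℝ), ∃ A : ℝ,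
    ∀ (v : ℝ → E3 → E3) (x₀ : E3) (T : ℝ → E3 → ℝ) (C₁ t₀ : ℝ), t₀ < 0 →
    ContDiffOn ℝ (⊤ : ℕ∞) (uncurry v) (Ioo t₀ 0 ×ˢ univ) →
    ContDiffOn ℝ (⊤ : ℕ∞) (uncurry T) (Ioo t₀ 0 ×ˢ ({x₀}ᶜ : Set E3)) →
    (∀ t ∈ Ioo t₀ 0, ∀ x, ‖v t x‖ ≤ C / Real.sqrt (-t)) →
    (∀ t ∈ Ioo t₀ 0, ∀ x, ‖curl (v t) x‖ ≤ C₁ / (-t)) →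
    (∀ t ∈ Ioo t₀ 0, ∀ x, curl (v t) x = cross (gradient (T t) x) (x - x₀)) →
    CurledLaw v x₀ T (Ioo t₀ 0) →
    (∀ t ∈ Ioo t₀ 0, ∀ r > 0, IsUnimodalSphere (T t) x₀ r) →
    ∀ t₁ t R : ℝ, t₀ < t₁ → t₁ ≤ t → t < 0 → 0 < R →
      ∫ r in Ioo 0 R, netFlux (T t) x₀ r
        ≤ A * C₁ * (1 + R / Real.sqrt (-t)) ^ 3 * (t / t₁) ^ lam

/-- **(TARGET OF THE LINE) Unimodal scalar Liouville in the Type-I class** = `CapSym.UnimodalScalarLiouville`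
(ns-idea-13's first non-axisymmetric rung of the wall) with the single extra hypothesis `∃ C, HasTypeITimeDecay C v`
= g0's Type-I wall `FarPastCollapse.StubScalarLiouvilleTypeI` restricted to saddle-free spheres. OPEN. -/
def UnimodalScalarLiouvilleTypeI : Prop :=
  ∀ (v : ℝ → E3 → E3) (x₀ : E3) (T : ℝ → E3 → ℝ),
    (∃ C : ℝ, HasTypeITimeDecay C v) →
    IsBoundedAncientMildSolution 1 v →
    (∀ t < 0, AEStronglyMeasurable (v t) volume) →
    ContDiffOn ℝ (⊤ : ℕ∞) (uncurry v) (Iio 0 ×ˢ univ) →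
    ContDiffOn ℝ (⊤ : ℕ∞) (uncurry T) (Iio 0 ×ˢ ({x₀}ᶜ : Set E3)) →
    (∃ C : ℝ, ∀ t < 0, ∀ x, |T t x| ≤ C) →
    (∀ t < 0, ∀ x, curl (v t) x = cross (gradient (T t) x) (x - x₀)) →
    CurledLaw v x₀ T (Iio 0) →
    (∀ t < 0, ∀ r > 0, IsUnimodalSphere (T t) x₀ r) →
    ∀ t < 0, ∀ x, cross (gradient (T t) x) (x - x₀) = 0

/-- **(RESIDUAL, typed) the multi-hill piece**: the same statement when SOME sphere at SOME time carries a saddle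
of `T(t)|_{S_r}`.  Here the EMF bound needs the mountain-pass variation of `T` between its global extrema and the
max-exchange radii carry an unsigned Bernoulli jump; no mechanism is claimed. OPEN. -/
def MultiHillScalarLiouvilleTypeI : Prop :=
  ∀ (v : ℝ → E3 → E3) (x₀ : E3) (T : ℝ → E3 → ℝ),
    (∃ C : ℝ, HasTypeITimeDecay C v) →
    IsBoundedAncientMildSolution 1 v →
    (∀ t < 0, AEStronglyMeasurable (v t) volume) →
    ContDiffOn ℝ (⊤ : ℕ∞) (uncurry v) (Iio 0 ×ˢ univ) →
    ContDiffOn ℝ (⊤ : ℕ∞) (uncurry T) (Iio 0 ×ˢ ({x₀}ᶜ : Set E3)) →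
    (∃ C : ℝ, ∀ t < 0, ∀ x, |T t x| ≤ C) →
    (∀ t < 0, ∀ x, curl (v t) x = cross (gradient (T t) x) (x - x₀)) →
    CurledLaw v x₀ T (Iio 0) →
    (∃ t < 0, ∃ r > 0, ¬ IsUnimodalSphere (T t) x₀ r) →
    ∀ t < 0, ∀ x, cross (gradient (T t) x) (x - x₀) = 0

/-! ### §4 The two compositions the line claims (recorded as a Prop, not claimed) -/

/-- THE LINE'S COMPOSITION (to be kernel-checked at crux-plan stage; recorded as a Prop, not claimed):
first lemma + a priori size + Type-I vorticity + the 1-D decay give S⁺, and S⁺ gives the unimodal target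
(ancient ⇒ `t₁ → −∞` ⇒ `w ≡ 0` ⇒ `T(t)` radial on spheres ⇒ `∇T × (x − x₀) = 0`). -/
def LineComposition : Prop :=
  (NetFluxSubsolution → OscLeVorticity → HalfLineOUDecay → NetFluxWindowDecay) ∧
  (NetFluxWindowDecay → TypeIVorticityBound → UnimodalScalarLiouvilleTypeI)


end Summit.NavierStokesRegularity.NavierStokesRegularity.Theorems.PoloidalLiouville.NetFlux

end
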